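import Literature.AlgebraicTopology.SingularHomology.CircleMapWinding
import Literature.AlgebraicTopology.SingularHomology.LoopClassesSpan
import Literature.AlgebraicTopology.SingularHomology.UniversalCoefficientsFree
import Literature.AlgebraicTopology.SingularHomology.HomologySpheres
import Literature.AlgebraicTopology.SingularHomology.TorusCohomologyRingChange
import Literature.AlgebraicTopology.SingularHomology.IntegralClassRingChange
import Mathlib.Topology.ContinuousMap.Algebra
import HarnessLib

/-!
# Circle-valued maps: windings, the Kronecker pairing of `φ^* θ`, and `(φ + ψ)^* θ = φ^* θ + ψ^* θ`
# with integral and arbitrary ring coefficients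

A. Hatcher, *Algebraic Topology* (2002), §3.1 p. 198 (`H¹(X; ℤ) = Hom(H₁(X), ℤ)` by the Kronecker
pairing, Thm. 3.2) with Thm. 1.7 / Prop. 1.30 (lifting through `ℝ → S¹`). For continuous maps
`φ, ψ : X → S¹ = ℝ/ℤ` into the circle GROUP, the pull-backs of the integral generator
`θ ∈ H¹(ℝ/ℤ)` (`circleClass`, `CircleIntegralCocycle.lean`) are additive in the map. Over a FIELD
`F` and for every space `X` this is the tree's `map_add_circleClass` / `map_sum_circleClass` /
`map_zsmul_circleClass` (`TorusCohomologyRing.lean`, by primitivity of `θ` on `T²`). THIS FILE gives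
the winding-number route, which yields the identity with INTEGRAL coefficients and hence with
coefficients in every commutative ring `R`, for path-connected `X`, together with the dictionary
between Kronecker pairings of `φ^* θ` and windings that the homology side of the torus needs
(`TorusCoordinateClasses.lean`): a continuous lift of `(φ + ψ) ∘ γ` through `ℝ → ℝ/ℤ` is the SUM of
lifts of `φ ∘ γ` and `ψ ∘ γ`, so windings add (`windAlong_add`, from `liftIncrement_eq_of_lift`,
`CircleMapWinding.lean`); the winding is the Kronecker pairing of `φ^* θ` with the loop class, in
every coefficient ring (`kroneckerPairing_map_circleClass_loopClass`); loop classes span `H₁` of a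
path-connected space (`singularHomology.linearMap_ext_loopClass`, Hatcher Thm. 2A.1); the Kronecker
map `H¹(X; ℤ) → Hom(H₁(X; ℤ), ℤ)` is injective because `H₀(X; ℤ)` is free
(`injective_kroneckerPairing_of_free`, `free_singularHomology_zero`); and the change of rings
`ℤ → R` transports the identity (`singularCohomology.ringChange_map`, `ringChange_circleClass`).

* `windAlong_zero/add/zsmul/sum/sum_zsmul` — the winding along a path is `ℤ`-linear in the map;
* `kroneckerPairing_circleClass_loopClass_eq_cast`, `kroneckerPairing_map_circleClass_loopClass` —
  `⟨φ^* θ_R, h_R(γ)⟩ = W_φ(h(γ))` cast to `R`, for every commutative ring `R`;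
* `windingFunctional_add(_loopClass)`, `windingFunctional_sum_zsmul(_loopClass)` — `W_{φ+ψ} = W_φ + W_ψ`;
* **`map_add_circleClass_int`**, `map_sum_zsmul_circleClass_int`, `map_zsmul_circleClass_int` — the
  identities in `H¹(X; ℤ)`; **`map_add_circleClass_of_commRing`**, `map_sum_zsmul_circleClass_of_commRing`,
  `map_zsmul_circleClass_of_commRing` — in `H¹(X; R)` for every commutative ring `R : Type`
  (`X` path connected).

Everything is proved; no named facts.

## References

* A. Hatcher, *Algebraic Topology*, CUP 2002, Thm. 1.7, Prop. 1.30, Thm. 2A.1, §3.1 p. 198,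
  Thm. 3.2, §3.C Exercise 11. [HatcherAT2002]
-/
noncomputable section

open CategoryTheory

universe v

namespace Literature.AlgebraicTopology.SingularHomology

open SingularSimplex singularChainComplex singularCochainComplex HurewiczProof

/-! ### The winding along a path is additive in the circle-valued map -/

section WindAlong

variable {X : Type} [TopologicalSpace X] {x y : X}

/-- The winding of the zero map vanishes. [cite: HatcherAT2002, Prop. 1.30] -/
theorem windAlong_zero (γ : Path x y) : windAlong (0 : C(X, UnitAddCircle)) γ = 0 := by
  rw [windAlong, liftIncrement_eq_of_lift (γ.map (0 : C(X, UnitAddCircle)).continuous) 0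
    (fun t => by rw [ContinuousMap.zero_apply, QuotientAddGroup.mk_zero]; rfl),
    ContinuousMap.zero_apply, ContinuousMap.zero_apply, sub_self]

/-- **Additivity of the winding**: `windAlong (φ + ψ) γ = windAlong φ γ + windAlong ψ γ` — the sum of
lifts of `φ ∘ γ` and `ψ ∘ γ` through `ℝ → ℝ/ℤ` is a lift of `(φ + ψ) ∘ γ`.
[cite: HatcherAT2002, Prop. 1.30] -/
theorem windAlong_add (φ ψ : C(X, UnitAddCircle)) (γ : Path x y) :
    windAlong (φ + ψ) γ = windAlong φ γ + windAlong ψ γ := by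
  have h := liftIncrement_eq_of_lift (γ.map (φ + ψ).continuous)
    (pathLift (γ.map φ.continuous) + pathLift (γ.map ψ.continuous)) (fun t => by
      rw [ContinuousMap.add_apply, QuotientAddGroup.mk_add, coe_pathLift, coe_pathLift]
      rfl)
  rw [windAlong, h, windAlong, windAlong, liftIncrement, liftIncrement, ContinuousMap.add_apply,
    ContinuousMap.add_apply]
  ring

/-- **Homogeneity of the winding**: `windAlong (k • φ) γ = k * windAlong φ γ` for an integer `k`.
[cite: HatcherAT2002, Prop. 1.30] -/
theorem windAlong_zsmul (k : ℤ) (φ : C(X, UnitAddCircle)) (γ : Path x y) :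
    windAlong (k • φ) γ = k * windAlong φ γ := by
  have h := liftIncrement_eq_of_lift (γ.map (k • φ).continuous)
    ⟨fun t => k * pathLift (γ.map φ.continuous) t,
      continuous_const.mul (pathLift (γ.map φ.continuous)).continuous⟩ (fun t => by
      show (((k * pathLift (γ.map φ.continuous) t : ℝ)) : UnitAddCircle) = _
      rw [← zsmul_eq_mul, QuotientAddGroup.mk_zsmul, coe_pathLift]
      rfl)
  rw [windAlong, h, windAlong, liftIncrement]
  show k * pathLift (γ.map φ.continuous) 1 - k * pathLift (γ.map φ.continuous) 0 = _
  ring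

/-- The winding of a finite sum of circle-valued maps is the sum of the windings.
[cite: HatcherAT2002, Prop. 1.30] -/
theorem windAlong_sum {ι : Type*} (s : Finset ι) (φ : ι → C(X, UnitAddCircle)) (γ : Path x y) :
    windAlong (∑ i ∈ s, φ i) γ = ∑ i ∈ s, windAlong (φ i) γ := by
  classical
  induction s using Finset.induction_on with
  | empty => rw [Finset.sum_empty, Finset.sum_empty, windAlong_zero]
  | insert i s hi ih => rw [Finset.sum_insert hi, Finset.sum_insert hi, windAlong_add, ih]

/-- The winding of an integral combination `Σᵢ kᵢ • φᵢ` is `Σᵢ kᵢ · windAlong φᵢ γ`.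
[cite: HatcherAT2002, Prop. 1.30] -/
theorem windAlong_sum_zsmul {ι : Type*} (s : Finset ι) (k : ι → ℤ) (φ : ι → C(X, UnitAddCircle))
    (γ : Path x y) : windAlong (∑ i ∈ s, k i • φ i) γ = ∑ i ∈ s, (k i : ℝ) * windAlong (φ i) γ := by
  rw [windAlong_sum]
  simp only [windAlong_zsmul]

end WindAlong

/-! ### The Kronecker pairing of `φ^* θ` with a loop class, in every coefficient ring -/

section Kronecker

variable (R : Type v) [CommRing R]

/-- **`⟨θ_R, h_R(p)⟩ = ϑ(p)`** for a loop `p` of `ℝ/ℤ` and every coefficient ring `R`: the generator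
of `H¹(ℝ/ℤ; R)` evaluated on the Hurewicz class of `p` is the (integer) winding cochain of `p`, cast
to `R` (the case `R = ℤ` is `kroneckerPairing_circleClass_loopClass`).
[cite: HatcherAT2002, §3.1 p. 191] -/
theorem kroneckerPairing_circleClass_loopClass_eq_cast {a : UnitAddCircle} (p : Path a a) :
    kroneckerPairing R R UnitAddCircle 1 (circleClass R) (loopClass R R (1 : R) p) =
      (windingCochain (ofPath p) : R) := by
  set K := singularChainComplex R R UnitAddCircle
  have hz : K.d 1 0 (single (R := R) (ofPath p) (1 : R)) = 0 := by
    rw [d_single_ofPath, sub_self]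
  let zc : cycles R R UnitAddCircle 1 := K.cyclesMk (single (R := R) (ofPath p) (1 : R)) 0 (by simp) hz
  have hzc : iCycles R R UnitAddCircle 1 zc =
      ∑ i ∈ (Finset.univ : Finset Unit), single (R := R) ((fun _ : Unit => ofPath p) i)
        ((fun _ : Unit => (1 : R)) i) := by
    rw [Finset.univ_unique, Finset.sum_singleton]
    exact K.i_cyclesMk _ 0 (by simp) hz
  have hcls : loopClass R R (1 : R) p = K.homologyπ 1 zc :=
    homologyCls_eq_homologyπ_cyclesMk _ _ 0 (by simp) hz
  rw [hcls, circleClass, kroneckerPairing_π_single Finset.univ (fun _ : Unit => ofPath p)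
    (fun _ : Unit => (1 : R)) (circleCocycle R) zc hzc, Finset.univ_unique, Finset.sum_singleton,
    iCocycles_circleCocycle, circleCochain_apply, smul_eq_mul, mul_one]

variable {X : Type} [TopologicalSpace X]

/-- **`⟨φ^* θ_R, h_R(γ)⟩ = W_φ(h(γ))`** in every coefficient ring `R`: the Kronecker pairing of the
pulled-back generator with the `R`-Hurewicz class of a loop `γ` is the integer winding
`W_φ(h(γ)) = windingFunctional φ (h γ)` of `φ` along `γ`, cast to `R`.
[cite: HatcherAT2002, §3.1 p. 198] -/
theorem kroneckerPairing_map_circleClass_loopClass (φ : C(X, UnitAddCircle)) {x : X} (γ : Path x x) :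
    kroneckerPairing R R X 1 (singularCohomology.map R R φ 1 (circleClass R)) (loopClass R R (1 : R) γ) =
      ((windingFunctional φ (loopClass ℤ ℤ (1 : ℤ) γ) : ℤ) : R) := by
  rw [kroneckerPairing_map, map_loopClass, kroneckerPairing_circleClass_loopClass_eq_cast,
    windingFunctional, kroneckerPairing_map, map_loopClass, kroneckerPairing_circleClass_loopClass]

end Kronecker

/-! ### The winding functional is additive in the map -/

section WindingFunctional

variable {X : Type} [TopologicalSpace X]

/-- `W_{φ+ψ}(h(γ)) = W_φ(h(γ)) + W_ψ(h(γ))` for every loop `γ`. [cite: HatcherAT2002, §3.1 p. 198] -/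
theorem windingFunctional_add_loopClass (φ ψ : C(X, UnitAddCircle)) {x : X} (γ : Path x x) :
    windingFunctional (φ + ψ) (loopClass ℤ ℤ (1 : ℤ) γ) =
      windingFunctional φ (loopClass ℤ ℤ (1 : ℤ) γ) + windingFunctional ψ (loopClass ℤ ℤ (1 : ℤ) γ) := by
  have h := windAlong_add φ ψ γ
  rw [← windingFunctional_loopClass, ← windingFunctional_loopClass, ← windingFunctional_loopClass] at h
  exact_mod_cast h

/-- `W_{Σ kᵢ φᵢ}(h(γ)) = Σ kᵢ W_{φᵢ}(h(γ))` for every loop `γ`. [cite: HatcherAT2002, §3.1 p. 198] -/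
theorem windingFunctional_sum_zsmul_loopClass {ι : Type*} (s : Finset ι) (k : ι → ℤ)
    (φ : ι → C(X, UnitAddCircle)) {x : X} (γ : Path x x) :
    windingFunctional (∑ i ∈ s, k i • φ i) (loopClass ℤ ℤ (1 : ℤ) γ) =
      ∑ i ∈ s, k i * windingFunctional (φ i) (loopClass ℤ ℤ (1 : ℤ) γ) := by
  have h := windAlong_sum_zsmul s k φ γ
  rw [← windingFunctional_loopClass] at h
  simp only [← windingFunctional_loopClass] at h
  exact_mod_cast h

variable [PathConnectedSpace X]

/-- **`W_{φ+ψ} = W_φ + W_ψ`** on `H₁(X; ℤ)` for `X` path connected (loop classes span `H₁`).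
[cite: HatcherAT2002, Thm. 2A.1] -/
theorem windingFunctional_add (φ ψ : C(X, UnitAddCircle)) :
    windingFunctional (φ + ψ) = windingFunctional φ + windingFunctional ψ := by
  obtain ⟨x₀⟩ := (inferInstance : PathConnectedSpace X).nonempty
  exact singularHomology.linearMap_ext_loopClass x₀ fun γ => by
    rw [LinearMap.add_apply, windingFunctional_add_loopClass]

/-- **`W_{Σ kᵢ φᵢ} = Σ kᵢ W_{φᵢ}`** on `H₁(X; ℤ)` for `X` path connected. [cite: HatcherAT2002, Thm. 2A.1] -/
theorem windingFunctional_sum_zsmul {ι : Type*} (s : Finset ι) (k : ι → ℤ)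
    (φ : ι → C(X, UnitAddCircle)) :
    windingFunctional (∑ i ∈ s, k i • φ i) = ∑ i ∈ s, k i • windingFunctional (φ i) := by
  obtain ⟨x₀⟩ := (inferInstance : PathConnectedSpace X).nonempty
  exact singularHomology.linearMap_ext_loopClass x₀ fun γ => by
    rw [windingFunctional_sum_zsmul_loopClass, LinearMap.sum_apply]
    simp only [LinearMap.smul_apply, smul_eq_mul]

end WindingFunctional

/-! ### `(φ + ψ)^* θ = φ^* θ + ψ^* θ` in `H¹(X; ℤ)` and in `H¹(X; R)` -/

section Cohomology

variable {X : Type} [TopologicalSpace X] [PathConnectedSpace X]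

/-- **`(φ + ψ)^* θ = φ^* θ + ψ^* θ` in `H¹(X; ℤ)`** for continuous `φ, ψ : X → ℝ/ℤ` on a path-connected
`X`: both sides have the same Kronecker functional `W_{φ+ψ} = W_φ + W_ψ` on `H₁(X; ℤ)`, and the
Kronecker map is injective on `H¹(X; ℤ)` (`H₀(X; ℤ)` is free). [cite: HatcherAT2002, §3.1 p. 198 and Thm. 3.2] -/
theorem map_add_circleClass_int (φ ψ : C(X, UnitAddCircle)) :
    singularCohomology.map ℤ ℤ (φ + ψ) 1 (circleClass ℤ) =
      singularCohomology.map ℤ ℤ φ 1 (circleClass ℤ) + singularCohomology.map ℤ ℤ ψ 1 (circleClass ℤ) := by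
  haveI := free_singularHomology_zero (X := X)
  apply injective_kroneckerPairing_of_free ℤ X 0
  rw [map_add]
  exact windingFunctional_add φ ψ

/-- **`(Σᵢ kᵢ • φᵢ)^* θ = Σᵢ kᵢ • φᵢ^* θ` in `H¹(X; ℤ)`** (`X` path connected, `kᵢ ∈ ℤ`).
[cite: HatcherAT2002, §3.1 p. 198 and Thm. 3.2] -/
theorem map_sum_zsmul_circleClass_int {ι : Type*} (s : Finset ι) (k : ι → ℤ)
    (φ : ι → C(X, UnitAddCircle)) :
    singularCohomology.map ℤ ℤ (∑ i ∈ s, k i • φ i) 1 (circleClass ℤ) =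
      ∑ i ∈ s, k i • singularCohomology.map ℤ ℤ (φ i) 1 (circleClass ℤ) := by
  haveI := free_singularHomology_zero (X := X)
  apply injective_kroneckerPairing_of_free ℤ X 0
  rw [map_sum]
  simp only [map_zsmul]
  exact windingFunctional_sum_zsmul s k φ

/-- `(k • φ)^* θ = k • φ^* θ` in `H¹(X; ℤ)` (`X` path connected, `k ∈ ℤ`).
[cite: HatcherAT2002, §3.1 p. 198 and Thm. 3.2] -/
theorem map_zsmul_circleClass_int (k : ℤ) (φ : C(X, UnitAddCircle)) :
    singularCohomology.map ℤ ℤ (k • φ) 1 (circleClass ℤ) =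
      k • singularCohomology.map ℤ ℤ φ 1 (circleClass ℤ) := by
  have h := map_sum_zsmul_circleClass_int (X := X) {(0 : Fin 1)} (fun _ => k) (fun _ => φ)
  rwa [Finset.sum_singleton, Finset.sum_singleton] at h

variable (R : Type) [CommRing R]

/-- **`(φ + ψ)^* θ = φ^* θ + ψ^* θ` in `H¹(X; R)`** for every commutative ring `R` and continuous
`φ, ψ : X → ℝ/ℤ` on a path-connected `X` (change of rings `ℤ → R` applied to
`map_add_circleClass_int`; `θ_R` is the image of `θ_ℤ`). For `R` a field (and any `X`) this is the
tree's `map_add_circleClass` (`TorusCohomologyRing.lean`). [cite: HatcherAT2002, §3.1 p. 198] -/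
theorem map_add_circleClass_of_commRing (φ ψ : C(X, UnitAddCircle)) :
    singularCohomology.map R R (φ + ψ) 1 (circleClass R) =
      singularCohomology.map R R φ 1 (circleClass R) + singularCohomology.map R R ψ 1 (circleClass R) := by
  have h := congrArg (singularCohomology.ringChange (Int.castRingHom R) X 1) (map_add_circleClass_int φ ψ)
  rwa [map_add, singularCohomology.ringChange_map, singularCohomology.ringChange_map,
    singularCohomology.ringChange_map, ringChange_circleClass] at h

/-- **`(Σᵢ kᵢ • φᵢ)^* θ = Σᵢ kᵢ • φᵢ^* θ` in `H¹(X; R)`** (`X` path connected, `kᵢ ∈ ℤ`, with the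
integers acting through `R`). [cite: HatcherAT2002, §3.1 p. 198] -/
theorem map_sum_zsmul_circleClass_of_commRing {ι : Type*} (s : Finset ι) (k : ι → ℤ) (φ : ι → C(X, UnitAddCircle)) :
    singularCohomology.map R R (∑ i ∈ s, k i • φ i) 1 (circleClass R) =
      ∑ i ∈ s, (k i : R) • singularCohomology.map R R (φ i) 1 (circleClass R) := by
  have h := congrArg (singularCohomology.ringChange (Int.castRingHom R) X 1)
    (map_sum_zsmul_circleClass_int s k φ)
  rw [map_sum, singularCohomology.ringChange_map, ringChange_circleClass] at h
  rw [h]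
  refine Finset.sum_congr rfl fun i _ => ?_
  rw [map_zsmul, singularCohomology.ringChange_map, ringChange_circleClass, Int.cast_smul_eq_zsmul]

/-- `(k • φ)^* θ = k • φ^* θ` in `H¹(X; R)` (`X` path connected, `k ∈ ℤ` acting through `R`).
[cite: HatcherAT2002, §3.1 p. 198] -/
theorem map_zsmul_circleClass_of_commRing (k : ℤ) (φ : C(X, UnitAddCircle)) :
    singularCohomology.map R R (k • φ) 1 (circleClass R) =
      (k : R) • singularCohomology.map R R φ 1 (circleClass R) := by
  have h := map_sum_zsmul_circleClass_of_commRing (X := X) R {(0 : Fin 1)} (fun _ => k) (fun _ => φ)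
  rwa [Finset.sum_singleton, Finset.sum_singleton] at h

end Cohomology

end Literature.AlgebraicTopology.SingularHomology

end
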